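import Summits.BirchSwinnertonDyer.BirchSwinnertonDyer.Theses.ByReductionTypeAtTwo
import Summits.BirchSwinnertonDyer.BirchSwinnertonDyer.Theorems.ByReductionTypeAtTwoRankOneAtTwoOneDoorLawSubsliceDefs
import Summits.BirchSwinnertonDyer.BirchSwinnertonDyer.Theorems.ByReductionTypeAtTwoRankOneAtTwoOneDoorLawFirstLayerDefs
import Summits.BirchSwinnertonDyer.BirchSwinnertonDyer.Theorems.ByReductionTypeAtTwoRankOneAtTwoBigImageOddLocalOneDoorSubsliceFirstLayerManinFree
import HarnessLib

/-!
# LINE v8.17 `one_door_analytic` for the crux `RankOneAtTwoBigImageOddLocal` (stmt-BirchSwinnertonDyer-23715)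
# — planner `bsd-f1-sign2-an` g11 (LENS analytic / Waldspurger–Gross–Zagier), MEMO-an v1.21 AN-28

Registered ALONGSIDE the lead's line of record `Lines/one_door_law.lean` (v7.2; never touched by this file).  Same door
(`P2.bsdp_two_iff_of_heegner_rankOne`), same carriers (`DoorAdmissible`, `transpCount` = `t`, `identCount` = `s`,
`HasTwoDivisibilityUpToTorsion` = `m`; all the TREE's, `Theorems/ByReductionTypeAtTwoRankOneAtTwoOneDoorLawDefs.lean`,
p610929), ONE change of lever:

**choose the door field by Waldspurger / Hoffstein–Luo NON-VANISHING, not by Selmer vanishing, and let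
`s_d := ord₂ #Ш(E^{(d)})[2^∞]` float.**

* v7.2 picks a `Sel₂(E^{(d)}) = 0` door (Mazur–Rubin, `DoorSupplyAtTwo`) and must then prove `L(E^{(d)},1) ≠ 0` — the rank-`0`
  `2`-CONVERSE for non-CM curves, open in print (the lead's 07:39Z reshaping names it as an OPEN analytic stub of
  `DoorTwistValueAtTwo`).
* v8 picks `d` with `L(E^{(d)},1) ≠ 0` DIRECTLY from the tree's named fact `HoffsteinLuo1997_exists_twist_L_one_ne_zero`
  (`d ≡ 1 (8)`, square-free, `(d/ℓ) = 1` at the odd bad `ℓ`; `d < 0` is forced by the sign `w(E) = −1`, tree theorem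
  `exists_neg_fundamental_twist_ne_zero_of_hoffsteinLuo`), and such a `d` IS door-admissible — PROVED below
  (`doorSupplyAnalyticAtTwo_of_pubHL`).  The price is that `Ш(E^{(d)})[2]` is no longer known to vanish; but `s_d` enters the
  index law and the value law with the SAME sign and CANCELS in the door formula (PROVED below, `doorGlueAn`):
  index `2m + [Δ<0] = s_E + s_d + t + 2s`, value `v₂ q_d = v₂ ∏c_ℓ(E) + t + 2s + s_d`, door
  `ord₂(8 I² t_W² /(n k² t_K² c² w² q_d |u| c_W)) = 1 + 2m − [Δ>0] − v₂ q_d = s_E`.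
  The value law with `s_d` is exactly rank-`0` `BSD₂` of the minimal twist model — i.e. the route's OWN four
  `…RankZeroAtTwo` cruxes at `Wd` (stub `stub_rankZeroAtTwo` = those items BY NAME) plus kernel twist arithmetic
  (`stub_twinArith`: `T(E^{(d)})` odd, `c_q(E^{(d)}) = 1 + #roots` at the `I₀*` door primes, `c_ℓ(E^{(d)}) = c_ℓ(E)` at `ℓ ∣ N`).

Net effect on the cone of 23715: the rank-`0` `2`-converse and the Mazur–Rubin supply DROP OUT; what is left open is
`DoorIndexLawFullAtTwo` (the lens' conjecture: Kolyvagin exactness at `2` in `E`-side currency, census ENGINE L j300076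
P27.1 = 597/597 certified rows, 166 of them with `s_d = 2`), `S_manin` (odd constant; open only for `4 ∣ N`), the route's
rank-`0` cruxes (which `closes` consumes anyway) and PRINT (`S_pub`, `S_pubHL`).  Mirror remark: route GenusKolyvaginAtTwo reads
rank-`0` `BSD₂(E)` from exactness over `K` plus `BSD₂` of a rank-`1` twin (`ExactDescentAtTwoOfFourFacts`, PROVED); this line is
the same descent with the roles of the pair swapped.  BSD is not proved by any of this.

v8.1 (08:2xZ, after the lead's 08:10Z note): the index law is now the PURE IDENTITY (no finiteness conjuncts) = the RHS of the lead's
`bsdp_two_iff_doorLawFull_at` (p615533), and its stub is guarded `S_pub → DoorIndexLawFullAtTwo`.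

Stubs (6, sorried): `stub_pub`, `stub_pubHL` (PRINT), `stub_doorIndexFull` (CONJECTURE, load-bearing), `stub_rankZeroAtTwo`
(route items by name), `stub_twinArith` (kernel, theorem-grade), `stub_manin`.  PROVED here: the supply
(`doorSupplyAnalyticAtTwo_of_pubHL`), the reduction-type exhaustion (`rankZeroTwin_of_rankZeroAtTwo`), the glue (`doorGlueAn`,
the lead's `stub_doorGlue` p611607 with `s_d` carried), the composition `comp`, and `RankOneAtTwoBigImageOddLocal_of` BY NAME.
Disproof used: none on file for this crux (no `Disproof.lean`, 2026-08-28T08:00Z).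

v8.2 (LEAD bsd-line-fkl-p1 g6, 2026-08-28T08:5xZ — LINE OF RECORD, supersedes `Lines/one_door_law.lean` v7.4): the statements
`S_pubHL`, `DoorSupplyAnalyticAtTwo`, `@[conjecture] DoorIndexLawFullAtTwo`, `DoorTwinValueAtTwo`, `S_rankZeroTwin`,
`DoorTwinValueAtTwoOfRankZero`, `S_doorGlueAn` are now the TREE's (`Theorems/…OneDoorLawDefs.lean` APPEND #3, p617185; bodies
v8.1 verbatim) and only `open`ed here; §1 (supply) and §3 (glue) are the tree theorems `doorSupplyAnalyticAtTwo_of_pubHL` /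
`doorGlueAn` (`Theorems/…OneDoorAnalyticGlue.lean`); the kernel stub `stub_twinArith` is DISCHARGED by the
width seat's tree theorem `doorTwinValueAtTwo_of_rankZeroTwin` (p616880, over `doorTwistTamagawaAtTwo` p616165) with modularity out
of `S_pub` (also filed by name as `RankOneAtTwoOneDoor.stub_twinArith` in `Theorems/…OneDoorAnalyticAssembly.lean`).  Sorries 6 → 5: `stub_pub`, `stub_pubHL` (PRINT), `stub_doorIndexFull` (AN-28, CONJECTURE,
load-bearing), `stub_rankZeroAtTwo` (the route's own four rank-`0` items), `stub_manin` (open only for `4 ∣ N`).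
v8.3 (LEAD g6, 2026-08-28T09:1xZ): the MANIN stub SPLIT — `stub_manin` is DERIVED (tree theorem `RankOneAtTwoOneDoor.s_manin_of`,
`Theorems/…OneDoorManin.lean`: optimal datum + Abbes–Ullmo / Česnavičius + ODD Néron multiplier from `E[2]` irreducible) from
`stub_maninPub : S_maninPub` (PRINT) and `stub_maninAdditive : ManinOddAdditiveLevelAtTwo` (OPEN only at additive level
`4 ∣ N_E`; tree `@[conjecture]`, `…OneDoorLawDefs.lean` APPEND #4).  Stubs: 6 = `stub_pub` · `stub_pubHL` · `stub_maninPub`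
(PRINT) · `stub_doorIndexFull` (AN-28, CONJECTURE, load-bearing) · `stub_rankZeroAtTwo` (route items) · `stub_maninAdditive`
(OPEN at `4 ∣ N`).  Every other statement of the line is a kernel theorem.
v8.4 (LEAD g7, 2026-08-28T09:5xZ): the MANIN-FREE reshape — the parametrisation constant is NOT an input of `BSD₂`.  The tree
door carries `c²` and needs only `c ≠ 0` (a theorem); v8.3 fixed an odd-`c` datum merely to set `v₂ c = 0`.  The load-bearing law
is now stated for EVERY datum with the correction `2·v₂(c)` carried (`@[conjecture] RankOneAtTwoOneDoor.DoorIndexLawFullCAtTwo`,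
AN-28c, `Theorems/…OneDoorLawCDefs.lean` p621906; = AN-28 on odd-`c` data, so every ENGINE-L row of AN-28 is a row of AN-28c;
still LOSSLESS: per-datum kernel iff `bsdp_two_iff_doorLawFullC_at`, `Theorems/…OneDoorFullC.lean` p621746), the glue takes ANY
datum, and a datum exists by modularity alone (`nonempty_modularParametrizationData_iff_exists_isNewformOf_unconditional`):
`doorGlueAnC` / `rankOneAtTwoBigImageOddLocal_of_oneDoorAnalyticC` (`Theorems/…OneDoorAnalyticAssemblyC.lean`).  REMOVED from
the skeleton (not inputs): `stub_maninPub` (Abbes–Ullmo, Česnavičius), `stub_maninAdditive` (`@[conjecture]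
ManinOddAdditiveLevelAtTwo`, the `2`-primary Manin conjecture at `4 ∣ N`), the derived `stub_manin`, and the discharged
`stub_twinArith` (its content is inside `doorGlueAnC` via `S_rankZeroTwin` + `doorTwistTamagawaAtTwo`).  Not adopted: REF2 v21-add1's
CNS split of the Manin stub — vacuous on this slice by Calegari–Emerton 2009 Thm. 1 (odd modular degree ⇒ even analytic rank).
Stubs: 4 = `stub_pub` · `stub_pubHL` (PRINT) · `stub_doorIndexFullC` (AN-28c, CONJECTURE, LOAD-BEARING) · `stub_rankZeroAtTwo`
(the route's OWN four rank-`0` items BY NAME).  BSD is not proved by any of this.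
v8.5 (LEAD g7 + width seat fkl-p2 g7, 2026-08-28T10:0xZ): PRINT made PRIMARY.  The width seat's `…OneDoorFullCPrimary.lean`
(`bsdp_two_iff_doorLawFullC_at_of_rank`, `doorGlueAnC_of_primary`, `rankOneAtTwoBigImageOddLocal_of_oneDoorAnalyticC_primary4`, over
its primary door p620211 and its rank-one GZK from four facts p621008) runs the Manin-free glue on the FOUR PRIMARY named facts
{`gross_zagier`, `kolyvagin`, `exists_isNewformOf`, `HoffsteinLuo1997_exists_twist_L_one_ne_zero`} — the composite
`rank_eq_analyticRank_of_analyticRank_le_one` (GZK over `ℚ`, bundling Murty–Murty for rank `0`), the derivable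
`hasEntireLFunction_rat` and the tree theorem `heegnerPointComplex_mem_range_map` leave the PRINT stub.  Stubs: 3 = `stub_pub4`
(PRINT ×4, the local conjunction `S_pub4` of the four tree facts) · `stub_doorIndexFullC : S_pub4 → DoorIndexLawFullCAtTwo` (AN-28c,
CONJECTURE, LOAD-BEARING) · `stub_rankZeroAtTwo` (route items).  Cone of 23715 = four primary printed theorems · ONE conjecture ·
the route's own rank-`0` cruxes.  BSD is not proved by any of this.
v8.6 (LEAD g8, 2026-08-28T10:5xZ): the HALVES RESHAPE.  The one open conjecture AN-28c is an IDENTITY between the index side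
`2m + [Δ_W<0]` and the `Ш` side `s_E + s_d + t + 2s + 2·v₂(c)`; by the width seat fkl-p2 g8's `doorValuationC_at`
(`Theorems/…OneDoorValuation.lean`: `ord₂ #Ш_an(W) = 2m + [Δ_W<0] − s_d − t − 2s − 2·v₂(c)` modulo print and `BSD₂` of the twin) each
INEQUALITY is one half of `BSD₂(W)` in Miller's currency.  The skeleton now carries the two halves as separate load-bearing stubs —
`@[conjecture] DoorIndexLawUpperCAtTwo` (AN-28c-U, `Ш`-side `≤` index-side: the EULER-SYSTEM half = Kolyvagin's bound with the exact power
of `2`, printed for odd `p` only — Kolyvagin 1990 / Gross 1991 / Cha 2005 Thm. 3 «ℓ odd») and `@[conjecture] DoorIndexLawLowerCAtTwo`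
(AN-28c-L, index-side `≤` `Ш`-side: the CONVERSE half = Kolyvagin's conjecture / `p`-converse / main-conjecture direction, W. Zhang 2014
`p ≥ 5`, JSW 2017 `p` odd), both tree statements (`…OneDoorLawCDefs.lean` APPEND #6, p626076) — and the split is LOSSLESS modulo print
(`doorIndexLawFullCAtTwo_iff_halves`, `Theorems/…OneDoorHalvesAssembly.lean`: the exponent exists and is unique at every door datum by
Gross–Zagier + Kolyvagin, `exists_unique_exponent_at_door`).  The halves are the E-side images of route GenusKolyvaginAtTwo's K-side stubs
`stub_upperBoundAtTwo` / `stub_lowerBoundAtTwo` of `KolyvaginExactAtTwo` (stmt-22137).  Stubs: 4 = `stub_pub4` (PRINT ×4) ·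
`stub_doorUpperC : S_pub4 → DoorIndexLawUpperCAtTwo` (AN-28c-U, CONJECTURE) · `stub_doorLowerC : S_pub4 → DoorIndexLawLowerCAtTwo`
(AN-28c-L, CONJECTURE) · `stub_rankZeroAtTwo` (route items); composition `rankOneAtTwoBigImageOddLocal_of_oneDoorAnalyticC_halves`.
Cone of 23715 = four primary printed theorems · TWO half-conjectures (jointly = `BSD₂` of the slice in Heegner-index currency) · the
route's own rank-`0` cruxes.  BSD is not proved by any of this.
v8.7 (LEAD g11, 2026-08-28T14:0xZ): the BOTTOM-RUNG reshape of the Euler-system half.  `stub_doorUpperC` (AN-28c-U) is SPLIT, losslessly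
(`doorIndexLawUpperCAtTwo_iff_bottomNeg_and_offBottomNeg`, `Theorems/…OneDoorLawBottomDefs.lean` p638178), into
`stub_doorUpperBottomNeg : S_pub4 → DoorIndexLawUpperCAtTwoBottomNeg` — U₀⁻, the corner `Δ_W < 0`, MINIMAL door (`t = 1`, `s = 0`), odd
constant, `m = 0`: `y_K ∉ 2E(K) ⟹ Ш(W)[2] = Ш(Wd)[2] = 0`, THEOREM-GRADE on paper by Kolyvagin's FIRST `2`-descent run over `ℚ` (`E` and
`E^K` share `E[2]`; their Selmer groups live in one `H¹(ℚ, E[2])` with local conditions equal off the one error place `q₀` and one line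
each at `q₀`), whose abstract engine — Gross 1991 §10 at `p = 2`, eigenspace-free — is the KERNEL theorem file
`Theorems/…OneDoorFirstDescentAtTwo.lean` (p637958: `res_errorPlace_ne_zero_of_relaxed`, `eq_zero_or_eq_heegner_of_mem_sel`,
`twinSel_eq_bot`); its arithmetic leaves are Gross's Prop. 6.2 (1)(2) at `2` for the FIRST layer (the `M = 2` face of route
GenusKolyvaginAtTwo's item 24880; no structure theorem 24882, no `±`-eigenspaces), Poitou–Tate (tree theorem
`poitouTate_sum_localTatePairing_eq_zero_holds`), local Tate duality for `E[2]` over `ℚ_ℓ`, Čebotarev at `M = 2` (tree theorem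
`equivariantChebotarevAtTwoR_proof`, item 27280), Mazur–Rubin 2010 Lemmas 2.2 (i)/2.10, Cassels–Tate parity (tree `CasselsTateParity`) and
Gross–Zagier–Kolyvagin ranks (PRINT) — and `stub_doorUpperOffBottomNeg : S_pub4 → DoorIndexLawUpperCAtTwoOffBottomNeg`, the honest
CONJECTURE-GRADE residue of U (`Δ_W > 0` = gk2 residual 24883; non-minimal doors = Heegner `2`-divisibility from genus excess; `m ≥ 1` =
higher layers, item 24882; even constants).  Stubs: 5 = `stub_pub4` (PRINT ×4) · `stub_doorUpperBottomNeg` (U₀⁻, THEOREM-GRADE) ·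
`stub_doorUpperOffBottomNeg` (CONJECTURE) · `stub_doorLowerC` (AN-28c-L, CONJECTURE) · `stub_rankZeroAtTwo` (route items); composition
`comp` via `doorIndexLawUpperCAtTwo_of_bottomNeg_of_offBottomNeg` then v8.6's `rankOneAtTwoBigImageOddLocal_of_oneDoorAnalyticC_halves`.
Disproof used: none on file (no `Disproof.lean` / `Negative/` for this crux, 2026-08-28T14:00Z).  BSD is not proved by any of this.
v8.8 (LEAD g11, 2026-08-28T14:5xZ): the bottom rung made SIGN-FREE.  The engine p637958 has an ABSTRACT error place; MEMO-es §18.11 (-es g9, U₀⁺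
`HeegnerCornerPosDiscAtTwo`) runs the same first `2`-descent at `Δ_W > 0` with the error place `∞` and REGULAR Kolyvagin primes (`Frob_ℓ` a transposition on
`E[2]`, inert in `K`; at `M = 2` the Euler-system congruences hold for them), where Gross's `Frob_ℓ = Frob_∞` primes are vacuous.  So the two corners are ONE
statement `DoorIndexLawUpperCAtTwoBottom` (`Theorems/…OneDoorLawBottomDefs.lean` APPEND #7b, p639188): MINIMAL door `t + 2s = [Δ_W < 0]` (one error place:
the transposition prime `q₀` when `Δ_W < 0`, the real place when `Δ_W > 0`), odd constant, `m = 0` ⟹ `Ш(W)[2] = Ш(Wd)[2] = 0`; THEOREM-GRADE on paper for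
both signs (all inputs in print or elementary: Gross 3.7/§4/5.4/6.2 verbatim at `M = 2` with regular primes, -es (I5) = 5 lines of algebra + Hasse, reciprocity,
Čebotarev, one-place Poitou–Tate / Cassels–Tate parity, Kramer 1981 Prop. 6 at `∞`, MR10 Lemmas 2.2/2.9/2.10).  Stubs: 5 = `stub_pub4` (PRINT ×4) ·
`stub_doorUpperBottom : S_pub4 → DoorIndexLawUpperCAtTwoBottom` (U₀, THEOREM-GRADE, both signs) · `stub_doorUpperOffBottom : S_pub4 →
DoorIndexLawUpperCAtTwoOffBottom` (CONJECTURE: non-minimal doors = Heegner `2`-divisibility from excess error places; `m ≥ 1` = higher layers, item 24882 /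
Kummer entanglement MEMO-es §18; even constants) · `stub_doorLowerC` · `stub_rankZeroAtTwo`; composition via `doorIndexLawUpperCAtTwo_of_bottom_of_offBottom`
(lossless: `doorIndexLawUpperCAtTwo_iff_bottom_and_offBottom`).  BSD is not proved by any of this.
v8.10 (LEAD g12, 2026-08-28T16:3xZ): the bottom rung SPLIT BY SIGN and its `Δ_W < 0` half REDUCED TO THE FIRST-LAYER CLASSES.  Landed since
v8.9 (all `--supports 23715`, kernel-checked): the lead's `…OneDoorKummerRestriction` (res ∘ κ naturality), `…OneDoorBottomHeegnerClass`
(`exists_heegnerClass_at`: the Heegner class `y = κ_ℚ(g)` with `res_K y = κ_K(P)`), Defs APPEND #2 (`plOfNat`, `KolNeg`, `structure FirstLayerClasses`,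
`FirstLayerClassesAtTwoBottomNeg`, `FirstDescentLeavesAtTwoBottomNeg/Pos` + the LOSSLESS split `firstDescentLeavesAtTwoBottom_of_neg_of_pos`),
`…OneDoorBottomAssemblyNeg` (`nonempty_firstDescentInput_neg`), `…OneDoorBottomCrossTransport`, `…OneDoorBottomAssemblyNegFull`
(`firstDescentLeavesAtTwoBottomNeg_of_classes`); the width seat fkl-p2 g10's leaves `…BottomLeavesLines/LeavesRec/NoInflationDefect/Cebotarev/
CebotarevHabitat/CebotarevCopy/Fields` (line₁/line₂/rec₁/rec₂/ceb₁/ceb₂/ceb₂' — Mazur–Rubin 2.2 (i), Poitou–Tate + local duality, Gross 9.1 at 2,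
Čebotarev at M = 2 incl. the twin copy).  So `stub_firstDescentLeaves` (v8.9) ↦ `stub_firstLayerClassesNeg : FirstLayerClassesAtTwoBottomNeg` (the SIX
first-layer fields `c₁, c₂, c_loc ×2, c_loc_iff ×2` at `Δ_W < 0` = Kolyvagin's `d(ℓ)` at `M = 2` descended to `ℚ` on `W`/`Wd` with Gross 6.1 off
`{ℓ, q₀}` and 6.2 (2) = route GenusKolyvaginAtTwo's item 24880 at `(M, m, l) = (1, 1, ℓ)` + descent) + `stub_firstDescentLeavesPos :
FirstDescentLeavesAtTwoBottomPos` (U₀⁺: `Δ_W > 0`, error place `∞`, regular Kolyvagin primes — leaves `line_inr_of_Δ_pos`, `rec_inr` exist, the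
regular-prime Čebotarev supply does not).  Stubs: 7 = `stub_pub4` · `stub_pubCT` (PRINT) · `stub_firstLayerClassesNeg` (24880 face, THEOREM-GRADE
modulo Gross 6.2 at p = 2) · `stub_firstDescentLeavesPos` (U₀⁺, THEOREM-GRADE) · `stub_doorUpperOffBottom` · `stub_doorLowerC` (conjecture-grade) ·
`stub_rankZeroAtTwo`.  Composition: `firstDescentLeavesAtTwoBottom_of_neg_of_pos (firstDescentLeavesAtTwoBottomNeg_of_classes …) …` then as v8.9.

v8.17 (LEAD g16 + width seat fkl-p2 g14, 2026-08-28T23:5xZ): THE FIRST LAYER MADE SIGN-FREE AND MANIN-FREE; THE RESIDUE SPLIT BY MECHANISM.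
(1) SIGN.  v8.16's two sign-split first-layer stubs — R⁻₀ `HeegnerNonDivisibilityAtSelmerTrivialPrimeDoorAtTwo` (`Δ_W < 0`, `Sel₂`-trivial transposition-prime
door) and -an's AN-13 `F1Sign2.HeegnerPointOnEggAtTwo` (`Δ_W > 0`, egg) — are ONE statement read at two kinds of minimal door: by the width seat's AN-34n
dictionary (`rationalPointEggKappaIndexDictionaryAtTwo`, p674563: on the egg up to torsion ⟺ `MeetsEgg` ∧ exponent `0`) AN-13 on its class is «exponent `0`»,
and by route GenusKolyvaginAtTwo's PROVED egg twist law `GenusKolyArch.eggTwistLawAtTwo_holds` (Kramer 1981 Prop. 6: EVERY desc-admissible twin of a rank-one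
`Ш[2] = 0` egg curve has `#Sel₂ = 1`) the egg class is exactly the `Δ_W > 0` locus of `Sel₂`-TRIVIAL MINIMAL doors (`t + 2s = [Δ_W < 0]`), as gk2-p4's
transposition supply makes the R⁻₀ class the `Δ_W < 0` locus — the supply is one sign-free unconditional theorem `exists_selmerTrivialMinimalDoor`.
(2) MANIN.  The parametrisation constant is NOT an input of `BSD₂` (v8.4; fkl-p2 g14's `…OneDoorSubsliceNegDiscFloat.lean` p676704: the door identity is
datum-covariant): at such a door the AN-28c identity reads `m = v₂(c)` for EVERY datum, and a Heegner point of exponent `v₂(c)` IS a lawful door datum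
(`hasLawfulDoorAtTwo_of_exponent_padicVal_at_minimalDoor`: `s_W = 0` from `Ш(W)[2] = 0`, `s_d = 0` from `#Sel₂(Wd) = 1`, door opened by Gross–Zagier) — so the
first layer is registered with a FLOATING exponent and the composition needs NO odd-constant datum, NO `S_manin`, NO bottom rung U₀ and hence NO Gross 1991
Prop. 3.7 (2): ONE stub **R₀⁺ `@[conjecture] HeegnerExponentAtSelmerTrivialMinimalDoorAtTwo`** (`Theorems/…OneDoorLawFirstLayerDefs.lean` APPEND #2, p677933;
its odd-`c` face R₀ `HeegnerNonDivisibilityAtSelmerTrivialMinimalDoorAtTwo` = W. Zhang 2014 Thm. 1.1 at `p = 2` in the `Sel₂`-rank-one instance, p675429) —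
KOLYVAGIN'S CONJECTURE AT `2`, sign-free.  (3) MECHANISM.  Off the first-layer locus {`Ш(W)[2] = 0`, `Δ_W < 0 ∨ MeetsEgg W`} exactly two populations remain
(fkl-p2 g14's `…OneDoorSubsliceResiduePlusPlusSplit.lean`, p674858; the «no odd-constant datum» population is ABSORBED by the floating exponent): **R_S
`@[conjecture] DoorIndexLawFullCAtTwoSomeDoorResidueSha`** (`Ш(W)[2] ≠ 0`: Kolyvagin exactness at `2` beyond the first layer, route GenusKolyvaginAtTwo 24882) and
**R_N `@[conjecture] DoorIndexLawFullCAtTwoSomeDoorResidueNonEgg`** (`Δ_W > 0`, `Ш(W)[2] = 0`, `E(ℚ) ⊂ E⁰(ℝ)`: the non-egg residual, 24883 / -an's `η_f = 0`),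
bodies VERBATIM fkl-p2's spelled hypotheses (APPEND #2).  Kernel facts (`Theorems/…OneDoorSubsliceFirstLayerManinFree.lean`): the supply; the per-datum lawful
lemma; `hasLawfulDoorAtTwo_of_heegnerExponent_firstLayer` (R₀⁺ ⟹ every curve of the locus is lawful, datum from modularity alone); the composition
**`rankOneAtTwoBigImageOddLocal_of_heegnerExponent_of_residueSha_of_residueNonEgg`** (Gross–Zagier + Kolyvagin + modularity + Hoffstein–Luo + R₀⁺ + R_S + R_N
+ the four rank-`0` cruxes ⟹ crux BY NAME; trichotomy on `Ш(W)[2] = 0` / sign / egg); LOSSLESS (`exponent_padicVal_of_bsdp_two_at_minimalDoor`,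
`heegnerExponent_of_rankOneAtTwoBigImageOddLocal_of_twoConverse`, `residueSha_and_residueNonEgg_of_rankOneAtTwoBigImageOddLocal`: crux ⟺ R₀⁺ ∧ R_S ∧ R_N modulo
PRINT⁴ + rank-`0` cruxes + the rank-`0` `2`-converse).  Companions: `…OneDoorSubsliceFirstLayer.lean` (p677210: R₀ ⟹ R⁻₀; R₀ puts the egg class on the sub-slice;
the odd-`c` composition; lossless both signs), `…OneDoorSubsliceFirstLayerCone.lean` (R⁻₀ ∧ AN-13 ⟹ R₀ mod print: the cone does not grow).  Stubs: 5 =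
`stub_pub4` (PRINT ×4: Gross–Zagier, Kolyvagin, modularity, Hoffstein–Luo) · **`stub_heegnerExponent : S_pub4 → HeegnerExponentAtSelmerTrivialMinimalDoorAtTwo`**
(R₀⁺, CONJECTURE) · **`stub_residueSha : S_pub4 → DoorIndexLawFullCAtTwoSomeDoorResidueSha`** (R_S, CONJECTURE) · **`stub_residueNonEgg : S_pub4 →
DoorIndexLawFullCAtTwoSomeDoorResidueNonEgg`** (R_N, CONJECTURE) · `stub_rankZeroAtTwo` (route items).  Cone of 23715 = FOUR primary printed theorems · THREE
single-mechanism conjectures · the route's own rank-`0` cruxes.  Disproof used: none on file (no `Disproof.lean` / `Negative/`, 2026-08-28T23:50Z).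
BSD is not proved by any of this.

v8.16 (LEAD g15 + width seat fkl-p2 g13, 2026-08-28T22:4xZ): R₊ SPLIT BY THE EGG CLASS — the `Δ_W > 0` twin of R⁻₀.  The width seat's
`Theorems/…OneDoorSubslicePosDisc.lean` (p671137): a minimal odd-constant non-vanishing admissible door datum whose Heegner point is rational-on-the-EGG up to
torsion IS a bottom-rung datum (egg lemma ⟹ `m = 0`, unconditional; non-vanishing again by Gross–Zagier), and under -an's EXISTING conjecture AN-13
`F1Sign2.HeegnerPointOnEggAtTwo` (-an g5, REF1 §31; census AN-10H♯ 4 387/4 387, AN-21) the whole class {`Δ_W > 0`, `Ш(W)[2] = 0`, `MeetsEgg W`, odd-constant datum}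
lies on the proved sub-slice (`hasBottomRungDoorAtTwo_of_heegnerPointOnEggAtTwo`; door SUPPLIED unconditionally by route GenusKolyvaginAtTwo's
`GenusKolyTwin.exists_silent_prime_heegnerField`).  Hence R₊ ⟸ AN-13 ∧ R₊₊ (`doorIndexLawFullCAtTwoSomeDoorResiduePlus_of_heegnerPointOnEggAtTwo_of_rest`, whose
`hrest` is VERBATIM the body of **R₊₊ `@[conjecture] DoorIndexLawFullCAtTwoSomeDoorResiduePlusPlus`** (`Theorems/…OneDoorLawSubsliceDefs.lean` APPEND #11: the ∀∃
residue off BOTH first-layer classes — `Ш(W)[2] ≠ 0`; `Δ_W > 0` off the egg; no odd-constant datum — on the first two of which the hypothesis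
`¬HasBottomRungDoorAtTwo W` is itself a theorem mod print, fkl-p2's `…OneDoorSubsliceDescentBits.lean`).  Stubs: 6 = `stub_pub4` · `stub_pub37` (PRINT) ·
`stub_heegnerNonDiv` (R⁻₀: Kolyvagin's conjecture at 2, `Δ_W < 0`) · `stub_heegnerOnEgg : S_pub4 → F1Sign2.HeegnerPointOnEggAtTwo` (R⁺₀ = AN-13, `Δ_W > 0`) ·
`stub_residuePlusPlus : S_pub4 → DoorIndexLawFullCAtTwoSomeDoorResiduePlusPlus` (R₊₊: higher layers) · `stub_rankZeroAtTwo` (route items).  Losslessness: as v8.15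
(R₊ ⟹ R₊₊ verbatim; R₊ ⟹ AN-13 on the class needs the rank-0 2-converse for the silent-prime twin, exactly as `…OneDoorSubsliceNegDiscConverse.lean` at Δ<0).
BSD is not proved by any of this.

v8.15 (LEAD g15, 2026-08-28T21:4xZ): THE RESIDUE SPLIT INTO R⁻₀ AND R₊.  On the class {`Δ_W < 0`, `Ш(W)[2] = 0`, an odd-constant datum exists} the v8.14 residue IS
Kolyvagin NON-DIVISIBILITY at a `Sel₂`-trivial prime door: route GenusKolyvaginAtTwo's width seat gk2-p4 supplies, UNCONDITIONALLY, an imaginary quadratic `K` and a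
prime `q₀` with `(d_K, q₀)` transposition-admissible (a MINIMAL door: `doorAdmissible_of_transpAdmissible`, `minimal_of_transpAdmissible`), the door open at `q₀`,
Heegner hypothesis and `#Sel₂(W^{(d_K)}) = 1` (`GenusKolyTransp.exists_transpAdmissible_door_twistSelmerTwoCard_eq_one`); a Heegner point over that `K` which is
NOT `2`-divisible modulo torsion is non-torsion, so `L(W^{(d_K)},1) ≠ 0` by Gross–Zagier (`twist_entireLFunction_ne_zero_of_hasTwoDivisibilityUpToTorsion_zero` — NO
2-converse), and the datum is a bottom-rung datum (`hasBottomRungDoorAtTwo_of_heegnerNonDivisibility`): the class lies IN the sub-slice.  Hence TWO registered residues: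
**R⁻₀ `@[conjecture] HeegnerNonDivisibilityAtSelmerTrivialPrimeDoorAtTwo`** (`Theorems/…OneDoorLawSubsliceDefs.lean` APPEND #9: `y_K ∉ 2E(K) + E(K)_tors` at such a
door — W. Zhang's theorem «Kolyvagin's conjecture» (Camb. J. Math. 2014, Thm 1.1; `p ≥ 5` in print) at `p = 2` in its simplest instance, L-free) and **R₊
`@[conjecture] DoorIndexLawFullCAtTwoSomeDoorResiduePlus`** (APPEND #10: v8.14's residue off that class — `Ш(W)[2] ≠ 0`, `Δ_W > 0`, no odd-constant datum).
Composition `rankOneAtTwoBigImageOddLocal_of_heegnerNonDivisibility_of_residuePlus` (`Theorems/…OneDoorSubsliceNegDisc.lean`): R⁻₀ ∧ R₊ ⟹ residue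
(`doorIndexLawFullCAtTwoSomeDoorOffSubslice_of_residuePlus_of_class`), then v8.14.  Losslessness: residue ⟹ R₊ verbatim; residue ⟹ R⁻₀ holds modulo the
rank-0 2-CONVERSE for the `Sel₂`-trivial twin only (the tree's rank-0 `BSD₂` consumes `analyticRank = 0`) — recorded, not typed.  Stubs: 5 = `stub_pub4` ·
`stub_pub37` (PRINT) · `stub_heegnerNonDiv : S_pub4 → HeegnerNonDivisibilityAtSelmerTrivialPrimeDoorAtTwo` (R⁻₀, CONJECTURE: Kolyvagin's conjecture at 2) ·
`stub_residuePlus : S_pub4 → DoorIndexLawFullCAtTwoSomeDoorResiduePlus` (R₊, CONJECTURE: higher layers) · `stub_rankZeroAtTwo` (route items).  BSD is not proved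
by any of this.

v8.14 (LEAD g15, 2026-08-28T2xZ): THE SUB-SLICE SPLIT INSIDE THE SKELETON.  Two kernel facts make v8.13's two universal conjecture-grade stubs
(`DoorIndexLawUpperCAtTwoOffBottom`: U at EVERY datum off the bottom rung; `DoorIndexLawLowerCAtTwo`: the converse at EVERY datum) far larger than the crux
needs: (1) the per-datum law is an EQUIVALENCE with `BSDp W 2` (`bsdp_two_iff_doorLawFullC_at_of_rank`, modulo GZ/Kolyvagin/modularity and `BSDp Wd 2`),
so the AN-28c identity at ONE door datum of `W` gives it at EVERY datum of `W`; (2) a curve WITH a bottom-rung door datum already has `BSDp W 2` (the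
sub-slice theorem `bsdp_two_of_exists_bottomRungDoor`, lead g14; CT-free via `doorIndexLawUpperCAtTwoBottom_of_print_ctFree`, width seat fkl-p2 g12), so at
all its OTHER data (non-minimal doors, `m ≥ 1`, even constants) both halves are THEOREMS modulo print + rank-0.  Hence ONE ∀∃ residue:
`@[conjecture] DoorIndexLawFullCAtTwoSomeDoorOffSubslice` (`Theorems/…OneDoorLawSubsliceDefs.lean`, APPEND #8: every `W` of the slice with NO bottom-rung
door datum — `¬ HasBottomRungDoorAtTwo W` — has SOME lawful door datum, `HasLawfulDoorAtTwo W`: a non-vanishing admissible door datum and exponent with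
`2m + [Δ_W<0] = s_W + s_d + t + 2s + 2·v₂(c)`; the door is the prover's CHOICE).  Composition `rankOneAtTwoBigImageOddLocal_of_someDoorOffSubslice`
(`Theorems/…OneDoorSubsliceSplit.lean`): case split on `HasBottomRungDoorAtTwo W` — yes ⇒ U₀ from print makes the datum lawful with `m = 0`; no ⇒ the
residue — then `bsdp_two_of_hasLawfulDoorAtTwo` (kernel iff ←, twin `BSD₂` from the rank-0 cruxes).  LOSSLESS modulo PRINT⁵ + rank-0 (same file):
v8.13's stubs ⟹ the residue (`doorIndexLawFullCAtTwoSomeDoorOffSubslice_of_offBottom_of_lowerC`) ⟹ the crux ⟹ AN-28c at EVERY datum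
(`doorIndexLawFullCAtTwo_of_someDoorOffSubslice`) ⟹ v8.13's stubs (`doorIndexLawUpperCAtTwoOffBottom_of_…`, `doorIndexLawLowerCAtTwo_of_…`).
Stubs: 4 = `stub_pub4` · `stub_pub37` (PRINT) · `stub_someDoorOffSubslice : S_pub4 → DoorIndexLawFullCAtTwoSomeDoorOffSubslice` (CONJECTURE, load-bearing:
`BSD₂` on the complement of the proved sub-slice, in Heegner-index currency) · `stub_rankZeroAtTwo` (route items).  Disproof used: none on file.
BSD is not proved by any of this.

v8.13 (LEAD g14 + width seat fkl-p2 g12, 2026-08-28T20:1xZ): CASSELS–TATE REMOVED.  The PRINT stub `stub_pubCT : exists_casselsTate_pairing (K := ℚ)`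
(Cassels 1962; used only for the parity of `dim Sel₂(Wd/ℚ)` in the bottom-rung frame, `twin_selmerTwo_even_at`) is DISCHARGED by tree theorems:
Mazur–Rubin 2010 Cor. 3.4 (i) with ONE `T`-place, DIRECTED, unconditional over every number field (route GenusKolyvaginAtTwo's width seats gk2-p4 g12 /
gk2-p5 g12: Poitou–Tate for Selmer structures `poitouTate_selmerStructure_duality_real_holds`, Tate's local Euler characteristic, Mazur–Rubin Lemmas
2.9–2.11 and Kramer's congruence for the framed identification) — `T = {q₀}` the transposition prime at `Δ_W < 0`
(`GenusKolyTwistLocal.natCard_selmerGroup_twist_directed_of_menu₅_frame`), `T = {∞}` at `Δ_W > 0` (`GenusKolyArch.natCard_selmerGroup_twist_shift_of_menu₅_inl`):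
with `#Sel₂(W/ℚ) = 2` from the E-side engine and `#Sel₂(Wd/ℚ) ≤ 2` from the twin engine MINUS parity, the strict direction (`#Sel₂(Wd) = 4`) is
excluded and the non-strict one gives `Sel₂(Wd/ℚ) = 0` — the width seat fkl-p2 g12's `Theorems/…OneDoorBottomFrameCTFree.lean` (p660513:
`card_twinSel_le_two₂`, `door_place_menu₅`, `selmerGroup_twin_eq_bot_of_neg/_of_pos/_of_minimal`, **`doorIndexLawUpperCAtTwoBottom_of_leaves_ctFree`**)
and `Theorems/…OneDoorBottomOfPrintCTFree.lean` (`doorIndexLawUpperCAtTwoBottom_of_print_ctFree : GZ → Kolyvagin → modularity → HL → Gross 3.7 (2) →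
DoorIndexLawUpperCAtTwoBottom`); the lead's parallel derivation through the `ℚ`-level fact `MazurRubin2010.cor34i_singleton_rat_holds` and the
parity input `heven` (work file OneDoorBottomNoCT.lean, report G14 §5) is the same theorem and is not landed separately.  Stubs: 5 = `stub_pub4` ·
`stub_pub37` (PRINT) · `stub_doorUpperOffBottom` · `stub_doorLowerC` (conjecture-grade) · `stub_rankZeroAtTwo` (route items); `comp` routes the bottom
rung through `doorIndexLawUpperCAtTwoBottom_of_leaves_ctFree`.  NET: U₀ = PRINT (Gross–Zagier, Kolyvagin, modularity, Hoffstein–Luo, Gross 3.7 (2)) +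
kernel glue, Cassels 1962 out of the cone; the proved sub-slice of the crux as ONE theorem is `bsdp_two_of_exists_bottomRungDoor`
(`Theorems/…OneDoorBottomSubslice.lean`, p660863; CT-free sequel `…OneDoorBottomSubsliceCTFree.lean`); the converse stub's `m = 0` layer is a theorem
(fkl-p2 g12 `doorIndexLawLowerCAtTwo_at_zero`, `…OneDoorLowerCBottomLayer.lean`), so `stub_doorLowerC`'s content sits entirely at `m ≥ 1`
(`doorIndexLawLowerCAtTwo_of_pos`).  BSD is not proved by any of this.

v8.12 (LEAD g13, 2026-08-28T19:xxZ): the WHOLE SIGN-FREE BOTTOM RUNG U₀ REDUCED TO PRINT.  `stub_firstDescentLeavesPos : FirstDescentLeavesAtTwoBottomPos`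
(U₀⁺, the `Δ_W > 0` corner: error place `∞`, REGULAR Kolyvagin primes) is DERIVED: the width seat fkl-p2 g11's regular-prime Čebotarev supply and
assembly (`Theorems/…OneDoorBottomPosStepB/PosCebotarev/PosAssembly.lean`: `exists_regularKolyvaginPrime_two`, `ceb₁/₂/₂'_pos_rat`,
`nonempty_firstDescentInput_pos`, `firstDescentLeavesAtTwoBottomPos_of_classes`) reduce it to the `Δ_W > 0` first-layer classes
`FirstLayerClassesAtTwoBottomPos` (`Theorems/…OneDoorFirstDescentPosDefs.lean`, regular primes `KolPos`), and the lead's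
`Theorems/…OneDoorBottomFirstLayerPos.lean` (`firstLayerClassesAtTwoBottomPos_of_kolyvaginRelationAtTwo`) derives those from item 24880 exactly as at
`Δ_W < 0`, the `ℚ_ℓ ⟷ K_λ` dictionaries at a regular prime being the lead's TRANSPOSITION-prime dictionary
(`Theorems/…OneDoorBottomTranspositionDictionary.lean`: a Frobenius with `(Δ_min/ℓ) = −1` acts on `E[2]` as a transposition, `E[2] = 𝔽₂P ⊕ 𝔽₂FP`,
no sign of `Δ`).  Stubs: 6 = `stub_pub4` · `stub_pubCT` · `stub_pub37` (PRINT) · `stub_doorUpperOffBottom` · `stub_doorLowerC` (conjecture-grade) ·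
`stub_rankZeroAtTwo` (route items).  NET: the bottom rung U₀ = `DoorIndexLawUpperCAtTwoBottom` of 23715 (Kolyvagin's first `2`-descent over `ℚ` at
EVERY minimal door, both signs of `Δ_W`) is PRINT + kernel glue — Gross–Zagier, Kolyvagin, modularity, Hoffstein–Luo, Cassels–Tate, Gross 3.7 (2);
the line's open content is exactly its two conjecture-grade halves off the bottom rung (`DoorIndexLawUpperCAtTwoOffBottom`, `DoorIndexLawLowerCAtTwo`)
and the route's rank-0 items.  BSD is not proved by any of this.

v8.11 (LEAD g13, 2026-08-28T1xZ): the `Δ_W < 0` first-layer classes REDUCED TO PRINT.  `stub_firstLayerClassesNeg : FirstLayerClassesAtTwoBottomNeg`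
(the six first-layer fields at `Δ_W < 0`) is DERIVED (`Theorems/…OneDoorBottomFirstLayerNeg.lean`,
`firstLayerClassesAtTwoBottomNeg_of_kolyvaginRelationAtTwo`) from route GenusKolyvaginAtTwo's item 24880 `KolyvaginRelationAtTwo` BY NAME, which
is itself a tree theorem modulo ONE print fact (`GenusExact.kolyvaginRelationAtTwo_of_frobeniusCongruence`): the classes are the two descents
to `ℚ` of Kolyvagin's `c(ℓ) ∈ H¹(K, E[2])` for a conductor-`ℓ` datum compatible with a conductor-`1` datum over the door's frame `(Dt, H.β, ι)`
(`…OneDoorBottomFirstLayerData.lean`: Gross's CM data, Shimura reciprocity at conductor `1`, `c(1) = κ_K(P) = res y`, Gross 5.4 at `2`, `±`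
descents); Gross 6.2 (1) over `ℚ` off `{ℓ, q₀}` is McCallum's Lemma 4.3 OVER `K` — at `p = 2` on the odd-Tamagawa slice a THEOREM with no
Heegner-divisor input (`…OneDoorBottomLemma43AtTwo.lean`: unramified class killed by `c_w(E/K) = c_v(E)` odd, Milne *ADT* I.3.8 PROVED in the
tree) — descended place by place (gk2's one-place transfers; `#E(ℚ_v)[2] = 1` at the `3`-cycle primes of `d_K` from minimality `t = 1`,
`s = 0`); Gross 6.2 (2) direct and across is item 24880 at `(M, m, l) = (1, 1, ℓ)` plus the `ℚ ⟷ K` dictionaries at the inert prime `ℓ`.  So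
`stub_firstLayerClassesNeg` ↦ `stub_pub37 : GrossLMS1991.prop37_2_frobeniusCongruence` (PRINT: Gross 1991 Prop. 3.7 (2) = Nekovář 2007 Prop. 4.9,
the Eichler–Shimura congruence for Heegner points; the tree's named fact, XL, no `_holds`).  Stubs: 7 = `stub_pub4` · `stub_pubCT` · `stub_pub37`
(PRINT) · `stub_firstDescentLeavesPos` (U₀⁺, THEOREM-GRADE) · `stub_doorUpperOffBottom` · `stub_doorLowerC` (conjecture-grade) · `stub_rankZeroAtTwo`
(route items).  NET: the corner U₀⁻ of 23715 (`DoorIndexLawUpperCAtTwoBottomNeg`: Kolyvagin's first `2`-descent over `ℚ` at a minimal `Δ_W < 0`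
door) is PRINT + kernel glue — Gross–Zagier, Kolyvagin, modularity, Hoffstein–Luo, Cassels–Tate, Gross 3.7 (2).  BSD is not proved by any of this.

v8.9 (LEAD g12, 2026-08-28T15:1xZ): the bottom rung INSTANTIATED down to its leaves.  The abstract engine now has TWO halves — E-side p637958
(`Sel₂(E/ℚ) = {0, y}` in `H¹(ℚ, E[2])`) and the twin side IN ITS OWN GROUP `H¹(ℚ, Wd[2])` (`Theorems/…OneDoorFirstDescentPairAtTwo.lean`, p641149:
cross form of Gross 6.2 (2), no `E[2] ≅ E^{(d)}[2]` transport, no Mazur–Rubin Lemma 2.10) — and is INSTANTIATED on the tree's carriers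
(`galH1Torsion · 2`, `locAt = selmerLocalKer` / `strictAt = torsionLocalKer` at every place of `ℚ`, `selmerGroup · 2`): the displayed inputs are
the record `FirstDescentInput W Wd` (`Theorems/…OneDoorFirstDescentDefs.lean`: error place `q₀`, Kolyvagin primes, `y = δ(T·y_K)`, first-layer
classes `c₁ ℓ`, `c₂ ℓ`; fields = Gross 6.2 (1)/(2) direct and across, reciprocity, Čebotarev at `M = 2`, MR10 Lemma 2.2 (i) at `q₀`), and the FRAME
`doorIndexLawUpperCAtTwoBottom_of_leaves` (`Theorems/…OneDoorBottomFrame.lean`: engine ∘ record, then the width seat fkl-p2 g10's Selmer-to-door glue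
`doorIndexLawUpperCAtTwoBottom_of_selmerTwo` and parity leaf `twin_selmerTwo_even_at`, Cassels–Tate) proves
`S_pub4 ∧ exists_casselsTate_pairing ∧ FirstDescentLeavesAtTwoBottom ⟹ DoorIndexLawUpperCAtTwoBottom`.  Accordingly `stub_doorUpperBottom` ↦
`stub_firstDescentLeaves : FirstDescentLeavesAtTwoBottom` («at every bottom-rung datum the input EXISTS»; THEOREM-GRADE, sign-free: `q₀ = v_{q₀}` +
Gross primes at `Δ_W < 0`, `q₀ = ∞` + regular primes at `Δ_W > 0`) + `stub_pubCT : exists_casselsTate_pairing` (PRINT, Cassels 1962 / AEC X.4.14,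
the tree's named fact).  Stubs: 6 = `stub_pub4` · `stub_pubCT` (PRINT) · `stub_firstDescentLeaves` (U₀'s input, THEOREM-GRADE; each field a fixed tree
signature: 6.2 at `M = 2` = the first-layer face of item 24880, reciprocity = gk2 `…DualityRat`, Čebotarev = gk2 27280 via p641149's discharge lemmas,
one-line conditions = local counts) · `stub_doorUpperOffBottom` · `stub_doorLowerC` · `stub_rankZeroAtTwo`.  BSD is not proved by any of this.
-/

noncomputable section

open scoped Classical

namespace Summit.BirchSwinnertonDyer.BirchSwinnertonDyer.Cruxes.RankOneAtTwoBigImageOddLocal.OneDoorAnalytic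

open WeierstrassCurve NumberField IsDedekindDomain Rat.HeightOneSpectrum Literature.NumberTheory.EllipticCurves
  Literature.NumberTheory.EllipticCurves.ModularForms
  Literature.NumberTheory.EllipticCurves.KrizLi2019
  Summit.BirchSwinnertonDyer.Rank1Residual.F1Sign2
  Summit.BirchSwinnertonDyer.Rank1Residual.F1Sign2.TranspositionDoor
  Summit.BirchSwinnertonDyer.Rank1Residual
  Summit.BirchSwinnertonDyer.BirchSwinnertonDyer.Theses.ByReductionTypeAtTwo
  Summit.BirchSwinnertonDyer.BirchSwinnertonDyer.Theorems.RankOneAtTwoOneDoor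

set_option autoImplicit false
set_option linter.dupNamespace false

/-! ### §0 The statements: the tree's (`…OneDoorLawDefs.lean` APPEND #3) — `S_pubHL`, `DoorSupplyAnalyticAtTwo`,
`DoorIndexLawFullAtTwo`, `DoorTwinValueAtTwo`, `S_rankZeroTwin`, `DoorTwinValueAtTwoOfRankZero`, `S_doorGlueAn`; plus the one
local conjunction of ROUTE decls: -/

/-- The route's four rank-`0` cruxes at `2`, BY NAME (items `GoodOrdinaryRankZeroAtTwo`, `SupersingularRankZeroAtTwo`,
`MultiplicativeRankZeroAtTwo`, `AdditiveRankZeroAtTwo` of route ByReductionTypeAtTwo; `closes` consumes them already). -/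
def S_rankZeroAtTwo : Prop :=
  GoodOrdinaryRankZeroAtTwo ∧ SupersingularRankZeroAtTwo ∧ MultiplicativeRankZeroAtTwo ∧ AdditiveRankZeroAtTwo

/-- PRINT, PRIMARY (v8.5): the four published theorems the line consumes, BY NAME (tree Literature facts, statements only):
Gross–Zagier 1986 Thm. I.6.3 (`gross_zagier`), Kolyvagin 1990 Thm. A (`kolyvagin`), modularity as a newform BCDT 2001 Thm. A
(`exists_isNewformOf`), Hoffstein–Luo 1997 (`HoffsteinLuo1997_exists_twist_L_one_ne_zero`). -/
def S_pub4 : Prop :=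
  (∀ (N : ℕ) [NeZero N] (W : WeierstrassCurve ℚ) (K : Type) [Field K] [NumberField K], gross_zagier N W K) ∧
    (∀ (N : ℕ) [NeZero N] (W : WeierstrassCurve ℚ) (K : Type) [Field K] [NumberField K], kolyvagin N W K) ∧
    exists_isNewformOf ∧ HoffsteinLuo1997_exists_twist_L_one_ne_zero

/-! ### §4 The stubs (v8.17: five) -/

/-- S1 PRINT, PRIMARY: Gross–Zagier, Kolyvagin, modularity as a newform, Hoffstein–Luo (four tree named facts, `S_pub4`). -/
theorem stub_pub4 : S_pub4 := by sorry
/-- S2₀⁺ R₀⁺ (v8.17, CONJECTURE-GRADE, load-bearing): `HeegnerExponentAtSelmerTrivialMinimalDoorAtTwo` — KOLYVAGIN'S CONJECTURE AT `2` WITH FLOATING EXPONENT: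
at every `Sel₂`-trivial MINIMAL door (`t + 2s = [Δ_W < 0]`, either sign) of a `Ш(W)[2] = 0` curve of the slice, the Heegner point of ANY parametrisation datum has
exact exponent `v₂(c)` modulo torsion (odd-`c` face = W. Zhang 2014 Thm 1.1 at `p = 2` in the `Sel₂`-rank-one instance; `p ≥ 5` in print).  Replaces v8.16's
R⁻₀ / AN-13 pair and absorbs the «no odd-constant datum» population of R₊₊.  Supplies of such doors are unconditional for both signs
(`exists_selmerTrivialMinimalDoor`).  Guarded by the primary PRINT `S_pub4`. -/
theorem stub_heegnerExponent : S_pub4 → HeegnerExponentAtSelmerTrivialMinimalDoorAtTwo := by sorry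
/-- S2_S R_S (v8.17, CONJECTURE-GRADE, load-bearing): `DoorIndexLawFullCAtTwoSomeDoorResidueSha` — every curve of the slice with `Ш(W)[2] ≠ 0` has SOME lawful
door datum (Kolyvagin exactness at `2` BEYOND the first layer: `s_W ≥ 2` forces `m ≥ 1` at every minimal door; route GenusKolyvaginAtTwo's 24882).  Guarded by
`S_pub4`. -/
theorem stub_residueSha : S_pub4 → DoorIndexLawFullCAtTwoSomeDoorResidueSha := by sorry
/-- S2_N R_N (v8.17, CONJECTURE-GRADE, load-bearing): `DoorIndexLawFullCAtTwoSomeDoorResidueNonEgg` — every curve of the slice with `Δ_W > 0`, `Ш(W)[2] = 0` and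
`E(ℚ) ⊂ E⁰(ℝ)` has SOME lawful door datum (the non-egg residual: every desc-admissible twin has `#Sel₂ = 4`, every door has `m ≥ 1`; 24883 / -an's `η_f = 0`).
Guarded by `S_pub4`. -/
theorem stub_residueNonEgg : S_pub4 → DoorIndexLawFullCAtTwoSomeDoorResidueNonEgg := by sorry
/-- S3 = route ByReductionTypeAtTwo's four `…RankZeroAtTwo` items BY NAME (closes when they close; not a target of this crux). -/
theorem stub_rankZeroAtTwo : S_rankZeroAtTwo := by sorry

/-! Record of earlier stubs no longer in the skeleton: `stub_pub37 : GrossLMS1991.prop37_2_frobeniusCongruence` (v8.11–v8.16, PRINT, Gross 1991 Prop. 3.7 (2) — the one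
print input of the bottom rung U₀; OFF THE PATH in v8.17: the composition case-splits on `Ш(W)[2] = 0` instead of on `HasBottomRungDoorAtTwo W`, so U₀ is not
consumed — the sub-slice theorem `bsdp_two_of_exists_bottomRungDoor` stays a standalone theorem), `stub_heegnerNonDiv : S_pub4 →
HeegnerNonDivisibilityAtSelmerTrivialPrimeDoorAtTwo` (v8.15–v8.16, R⁻₀) + `stub_heegnerOnEgg : S_pub4 → F1Sign2.HeegnerPointOnEggAtTwo` (v8.16, R⁺₀ = AN-13)
(MERGED in v8.17 into the sign-free floating-exponent `stub_heegnerExponent` (R₀⁺): `heegnerNonDivisibilityMinimalDoor_of_heegnerExponent` (R₀⁺ ⟹ R₀),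
`heegnerNonDivisibilityAtSelmerTrivialPrimeDoorAtTwo_of_minimalDoor` (R₀ ⟹ R⁻₀), `hasBottomRungDoorAtTwo_of_kolyvaginTwo_posDisc` (R₀ ⟹ the egg class on the
sub-slice), `kolyvaginTwo_of_heegnerNonDiv_of_heegnerPointOnEgg` (R⁻₀ ∧ AN-13 ⟹ R₀ mod print)), `stub_residuePlusPlus : S_pub4 →
DoorIndexLawFullCAtTwoSomeDoorResiduePlusPlus` (v8.16, R₊₊; SPLIT in v8.17 into `stub_residueSha` (R_S) + `stub_residueNonEgg` (R_N) — fkl-p2 g14's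
`residuePlusPlus_iff_populations`; its third population «no odd-constant datum» is absorbed by R₀⁺'s floating exponent), `stub_residuePlus : S_pub4 → DoorIndexLawFullCAtTwoSomeDoorResiduePlus` (v8.15, R₊; SPLIT in v8.16 into
`stub_heegnerOnEgg` (R⁺₀ = AN-13) + `stub_residuePlusPlus` (R₊₊): `doorIndexLawFullCAtTwoSomeDoorResiduePlus_of_heegnerPointOnEggAtTwo_of_rest`; R₊ ⟹ R₊₊
verbatim), `stub_someDoorOffSubslice : S_pub4 → DoorIndexLawFullCAtTwoSomeDoorOffSubslice` (v8.14, the ONE ∀∃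
residue; SPLIT in v8.15 into `stub_heegnerNonDiv` (R⁻₀) + `stub_residuePlus` (R₊): `doorIndexLawFullCAtTwoSomeDoorOffSubslice_of_heegnerNonDivisibility_of_residuePlus`;
residue ⟹ R₊ verbatim, residue ⟹ R⁻₀ modulo the rank-0 2-converse for the twin), `stub_doorUpperOffBottom : S_pub4 → DoorIndexLawUpperCAtTwoOffBottom` + `stub_doorLowerC :
S_pub4 → DoorIndexLawLowerCAtTwo` (v8.8–v8.13, the two universal conjecture-grade halves; REPLACED in v8.14 by the one ∀∃ residue
`stub_someDoorOffSubslice`, lossless modulo print + rank-0: `doorIndexLawUpperCAtTwoOffBottom_of_someDoorOffSubslice`, `doorIndexLawLowerCAtTwo_of_someDoorOffSubslice`,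
`doorIndexLawFullCAtTwoSomeDoorOffSubslice_of_offBottom_of_lowerC`), `stub_pubCT : exists_casselsTate_pairing (K := ℚ)` (v8.9–v8.12, PRINT, Cassels 1962 — the parity of
`dim Sel₂(Wd/ℚ)` in the bottom-rung frame; DISCHARGED in v8.13 by Mazur–Rubin Cor. 3.4 (i) with one `T`-place, a tree theorem:
`doorIndexLawUpperCAtTwoBottom_of_leaves_ctFree`, `Theorems/…OneDoorBottomFrameCTFree.lean`, width seat fkl-p2 g12), `stub_firstDescentLeavesPos : FirstDescentLeavesAtTwoBottomPos` (v8.10–v8.11, U₀⁺; DERIVED in v8.12 from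
`stub_pub37` through item 24880: `firstLayerClassesAtTwoBottomPos_of_kolyvaginRelationAtTwo` + the width seat's `firstDescentLeavesAtTwoBottomPos_of_classes`),
`stub_firstLayerClassesNeg : FirstLayerClassesAtTwoBottomNeg` (v8.10, the `Δ_W < 0`
first-layer classes; DERIVED in v8.11 from `stub_pub37` through item 24880: `firstLayerClassesAtTwoBottomNeg_of_kolyvaginRelationAtTwo
(kolyvaginRelationAtTwo_of_frobeniusCongruence stub_pub37)`), `stub_doorUpperBottom : S_pub4 → DoorIndexLawUpperCAtTwoBottom` (v8.8, U₀ in door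
currency; DERIVED in v8.9 from `stub_pub4` + `stub_pubCT` + `stub_firstDescentLeaves` by the kernel frame `doorIndexLawUpperCAtTwoBottom_of_leaves`),
`stub_doorUpperBottomNeg : S_pub4 → DoorIndexLawUpperCAtTwoBottomNeg` +
`stub_doorUpperOffBottomNeg` (v8.7, the `Δ_W < 0` corner; SUBSUMED by v8.8's sign-free pair — `doorIndexLawUpperCAtTwoBottomNeg_of_bottom`),
`stub_doorUpperC : S_pub4 → DoorIndexLawUpperCAtTwo` (v8.6; SPLIT by v8.7/v8.8, lossless: `doorIndexLawUpperCAtTwo_iff_bottom_and_offBottom`),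
`stub_doorIndexFullC : S_pub4 → DoorIndexLawFullCAtTwo` (v8.5; SPLIT by v8.6 into
`stub_doorUpperC` + `stub_doorLowerC`, lossless: `doorIndexLawFullCAtTwo_iff_halves`), `stub_twinArith` (DISCHARGED, p616880/p616165; inside the glue),
`stub_maninPub` / `stub_maninAdditive` / `stub_manin` (REMOVED by v8.4 — the parametrisation constant floats; `S_manin`,
`S_maninPub`, `ManinOddAdditiveLevelAtTwo` stay in the tree as statements, consumed by nothing on this line), `stub_doorIndexFull`
(AN-28; superseded by AN-28c, `doorIndexLawFullAtTwo_of_doorIndexLawFullCAtTwo`), `stub_pub` / `stub_pubHL` (v8.4 PRINT over the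
composite GZK fact; superseded by the primary `stub_pub4`, v8.5). -/

/-! ### §5 Composition -/

/-- Local name for the route crux (so that `comp` is not itself a second crux-concluding theorem). -/
def Crux : Prop :=
  Summit.BirchSwinnertonDyer.BirchSwinnertonDyer.Theses.ByReductionTypeAtTwo.RankOneAtTwoBigImageOddLocal

/-- Kernel-checked composition (v8.17): the five stub STATEMENTS give the crux —
`rankOneAtTwoBigImageOddLocal_of_heegnerExponent_of_residueSha_of_residueNonEgg` (`Theorems/…OneDoorSubsliceFirstLayerManinFree.lean`: every curve of the slice is
LAWFUL — `Ш(W)[2] ≠ 0` by R_S; `Ш(W)[2] = 0` with `Δ_W < 0` or on the egg by R₀⁺ at the supplied `Sel₂`-trivial minimal door, ANY datum from modularity;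
`Δ_W > 0` off the egg by R_N — and one lawful datum gives `BSDp W 2` by the per-datum kernel iff with twin `BSD₂` from the route's four rank-`0` cruxes). -/
theorem comp : S_pub4 → (S_pub4 → HeegnerExponentAtSelmerTrivialMinimalDoorAtTwo) → (S_pub4 → DoorIndexLawFullCAtTwoSomeDoorResidueSha) →
    (S_pub4 → DoorIndexLawFullCAtTwoSomeDoorResidueNonEgg) → S_rankZeroAtTwo → Crux := by
  rintro h1 hR hS hN ⟨hO, hSs, hM, hA⟩
  exact rankOneAtTwoBigImageOddLocal_of_heegnerExponent_of_residueSha_of_residueNonEgg h1.1 h1.2.1 h1.2.2.1 h1.2.2.2 (hR h1) (hS h1) (hN h1)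
    ⟨hO, hM, hSs, hA⟩

/-- THE SKELETON: the crux BY NAME (type literally the route decl) from exactly the five registered stubs, through `comp`. -/
theorem RankOneAtTwoBigImageOddLocal_of :
    Summit.BirchSwinnertonDyer.BirchSwinnertonDyer.Theses.ByReductionTypeAtTwo.RankOneAtTwoBigImageOddLocal :=
  comp stub_pub4 stub_heegnerExponent stub_residueSha stub_residueNonEgg stub_rankZeroAtTwo

end Summit.BirchSwinnertonDyer.BirchSwinnertonDyer.Cruxes.RankOneAtTwoBigImageOddLocal.OneDoorAnalytic

end
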